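import Mathlib
import Literature.Computability.Complexity.CliqueTestGraphs
import Summits.PneNP.PneNP.Theorems.ConvexRankGatesConvexGateBlindRankForm

/-!
# PneNP / ConvexRankGates — `ConvexGateBlind`: the ε-structure of the canonical cone-rank form

Helpers (`--supports stmt-PneNP-10680`). The crux is kernel-equivalent
(`convexGateBlind_iff_cliqueDistConeRankHard`, `…CanonicalForm.lean`) to: for some `δ ∈ (0,1/2)`, every `c`,
eventually in `m`, for EVERY `ε > 0`, the shifted one-sided clique-distance matrix `D - εJ`,
`D[Q,u] = #(E(Q) ∖ u)` (`Q` the `k`-sets, `u` the `k`-clique-free graphs, `k = ⌈m^δ⌉₊`), has no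
`(PSD_q ⊕ ℝ^r_{≥0})`-factorisation with `q + r ≤ m^c`. This file records how that statement depends on `ε`:

* `cliqueDist_coneFactorisation_of_le` — **monotonicity in ε.** A factorisation of `D - ε'J` of size `(q, r)`
  yields one of `D - εJ` of size `(q, r + 1)` for every `0 < ε ≤ ε'` (`D - εJ = (D - ε'J) + (ε' - ε) J`, one more
  non-negative rank-one term; Hrubeš 2020 p. 7). So SMALL `ε` is the easy side for the factoriser and the hard side
  for the lower bound:
  the crux is the `ε → 0⁺` limit (Hrubeš's "ε-sensitive" lower bounds), and a refutation needs a small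
  factorisation at ONE `ε ∈ (0,1]` only — equivalently (up to one term) at `ε = 1`, where `D - J ≥ 0` has the
  zero pattern "u misses exactly one edge of Q" (the slack matrix of the polyhedral pair
  `conv{𝟙_{E(Q)}} + ℝ^E_{≥0} ⊆ {x ≥ 0 : x(E ∖ u) ≥ 1 ∀ u}`).
* `cliqueDist_noConeFactorisation_of_one_lt` — **`ε > 1` is vacuous**: for `2 ≤ k ≤ m` there is a critical pair
  (`Q = {0,…,k-1}`, `u` = the complete `(k-1)`-partite graph of the colouring `i ↦ min(i, k-2)`, which misses
  exactly the edge `{k-2, k-1}` of `Q`), where `D - ε < 0 ≤ tr(H Y) + ∑ U V`.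
* `cliqueDistConeRankHard_iff_small_eps` — hence the canonical statement is equivalent to its restriction to
  polynomially small shifts `0 < ε ≤ m^{-c}` (all larger `ε` come for free).
[folklore; the `+1` monotonicity is Hrubeš 2020 (ECCC TR19-034), remark after Lemma 14]
-/

namespace Summit.PneNP.PneNP.Theorems

open Matrix Finset Literature.Computability.Complexity

/-- **Monotonicity in `ε`.** From a `(PSD_q ⊕ ℝ^r_{≥0})`-factorisation of `D - ε'J` (on the `k`-sets × the
`k`-clique-free graphs) one gets a `(PSD_q ⊕ ℝ^{r+1}_{≥0})`-factorisation of `D - εJ` for every `0 < ε ≤ ε'`: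
`D - εJ = (D - ε'J) + (ε' - ε)·𝟙 ⊗ 𝟙`, the PSD parts unchanged. [cite: Hrubes2020, remark after Lemma 14] -/
theorem cliqueDist_coneFactorisation_of_le {m k q r : ℕ} {ε ε' : ℝ} (hεε' : ε ≤ ε')
    (H : ((⊤ : SimpleGraph (Fin m)).edgeSet → Bool) → Matrix (Fin q) (Fin q) ℝ)
    (Y : Finset (Fin m) → Matrix (Fin q) (Fin q) ℝ)
    (U : ((⊤ : SimpleGraph (Fin m)).edgeSet → Bool) → Fin r → ℝ) (V : Fin r → Finset (Fin m) → ℝ)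
    (hU : ∀ u l, 0 ≤ U u l) (hV : ∀ l Q, 0 ≤ V l Q)
    (hfact : ∀ (Q : Finset (Fin m)) (u : (⊤ : SimpleGraph (Fin m)).edgeSet → Bool), Q.card = k →
      cliqueFn m k u = false →
        (∑ e, if cliqueVec Q e = true ∧ u e = false then (1 : ℝ) else 0) - ε' =
          (H u * Y Q).trace + ∑ l, U u l * V l Q) :
    ∃ (U' : ((⊤ : SimpleGraph (Fin m)).edgeSet → Bool) → Fin (r + 1) → ℝ)
      (V' : Fin (r + 1) → Finset (Fin m) → ℝ),
      (∀ u l, 0 ≤ U' u l) ∧ (∀ l Q, 0 ≤ V' l Q) ∧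
      ∀ (Q : Finset (Fin m)) (u : (⊤ : SimpleGraph (Fin m)).edgeSet → Bool), Q.card = k →
        cliqueFn m k u = false →
          (∑ e, if cliqueVec Q e = true ∧ u e = false then (1 : ℝ) else 0) - ε =
            (H u * Y Q).trace + ∑ l, U' u l * V' l Q := by
  refine ⟨fun u => Fin.snoc (U u) (ε' - ε), Fin.snoc V (fun _ => 1), ?_, ?_, ?_⟩
  · intro u l
    refine Fin.lastCases ?_ (fun i => ?_) l
    · simp only [Fin.snoc_last]
      linarith
    · simp only [Fin.snoc_castSucc]
      exact hU u i
  · intro l Q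
    refine Fin.lastCases ?_ (fun i => ?_) l
    · simp only [Fin.snoc_last]
      norm_num
    · simp only [Fin.snoc_castSucc]
      exact hV i Q
  · intro Q u hQ hu
    rw [Fin.sum_univ_castSucc]
    simp only [Fin.snoc_castSucc, Fin.snoc_last, mul_one]
    have hf := hfact Q u hQ hu
    linarith

/-! ### `ε > 1` is vacuous: an explicit critical pair -/

/-- The critical pair: inside `Q = {0,…,k-1}` the colouring `i ↦ min(i, k-2)` is monochromatic only on the
edge `{k-2, k-1}`, so at most one edge `e ⊆ Q` is switched off in its colouring vector. [folklore] -/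
private theorem critical_edge_eq {m k : ℕ} (hk : 2 ≤ k) (hkm : k ≤ m)
    (e : (⊤ : SimpleGraph (Fin m)).edgeSet)
    (hQ : cliqueVec ((univ : Finset (Fin k)).image (Fin.castLE hkm)) e = true)
    (hc : colorVec (fun i : Fin m => (⟨min i.val (k - 2), by omega⟩ : Fin (k - 1))) e = false) :
    (e : Sym2 (Fin m)) = s(⟨k - 2, by omega⟩, ⟨k - 1, by omega⟩) := by
  classical
  obtain ⟨e, he⟩ := e
  induction e using Sym2.ind with
  | h x y =>
    have hxy : x ≠ y := by simpa using he
    simp only [cliqueVec, Sym2.mem_iff, forall_eq_or_imp, forall_eq, decide_eq_true_eq,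
      Finset.mem_image, Finset.mem_univ, true_and] at hQ
    obtain ⟨⟨jx, hjx⟩, ⟨jy, hjy⟩⟩ := hQ
    have hxk : x.val < k := by rw [← hjx]; simp
    have hyk : y.val < k := by rw [← hjy]; simp
    simp only [colorVec, Sym2.map_mk, Sym2.mk_isDiag_iff, Bool.not_eq_false',
      decide_eq_true_eq, Fin.mk.injEq] at hc
    have hxy' : x.val ≠ y.val := fun h => hxy (Fin.ext h)
    change s(x, y) = _
    rw [Sym2.eq_iff]
    simp only [Fin.ext_iff]
    omega

/-- **`ε > 1` is vacuous.** For `2 ≤ k ≤ m` no `(PSD ⊕ ℝ_{≥0})`-factorisation of `D - εJ` with `ε > 1`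
exists, of any size: at the critical pair (`Q = {0,…,k-1}`, `u` = the complete `(k-1)`-partite graph of
`i ↦ min(i,k-2)`, which is `k`-clique-free and misses at most one edge of `Q`) the left-hand side
`D[Q,u] - ε ≤ 1 - ε` is negative while `tr(H_u Y_Q) + ∑_l U_{u,l} V_{l,Q} ≥ 0`. [folklore] -/
theorem cliqueDist_noConeFactorisation_of_one_lt {m k q r : ℕ} (hk : 2 ≤ k) (hkm : k ≤ m) {ε : ℝ}
    (hε : 1 < ε)
    (H : ((⊤ : SimpleGraph (Fin m)).edgeSet → Bool) → Matrix (Fin q) (Fin q) ℝ)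
    (Y : Finset (Fin m) → Matrix (Fin q) (Fin q) ℝ)
    (U : ((⊤ : SimpleGraph (Fin m)).edgeSet → Bool) → Fin r → ℝ) (V : Fin r → Finset (Fin m) → ℝ)
    (hH : ∀ u, cliqueFn m k u = false → (H u).PosSemidef)
    (hY : ∀ Q : Finset (Fin m), Q.card = k → (Y Q).PosSemidef)
    (hU : ∀ u l, 0 ≤ U u l) (hV : ∀ l Q, 0 ≤ V l Q) :
    ¬ ∀ (Q : Finset (Fin m)) (u : (⊤ : SimpleGraph (Fin m)).edgeSet → Bool), Q.card = k →
        cliqueFn m k u = false →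
          (∑ e, if cliqueVec Q e = true ∧ u e = false then (1 : ℝ) else 0) - ε =
            (H u * Y Q).trace + ∑ l, U u l * V l Q := by
  classical
  intro hfact
  set Q : Finset (Fin m) := (univ : Finset (Fin k)).image (Fin.castLE hkm) with hQdef
  set h : Fin m → Fin (k - 1) := fun i => ⟨min i.val (k - 2), by omega⟩ with hhdef
  have hQcard : Q.card = k := by
    rw [hQdef, Finset.card_image_of_injective _ (Fin.castLE_injective hkm), Finset.card_univ,
      Fintype.card_fin]
  have hu : cliqueFn m k (colorVec h) = false := cliqueFn_colorVec h (by omega)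
  have hD : (∑ e, if cliqueVec Q e = true ∧ colorVec h e = false then (1 : ℝ) else 0) ≤ 1 := by
    rw [Finset.sum_boole]
    have : #(univ.filter fun e : (⊤ : SimpleGraph (Fin m)).edgeSet =>
        cliqueVec Q e = true ∧ colorVec h e = false) ≤ 1 := by
      refine Finset.card_le_one.2 fun e he e' he' => ?_
      simp only [Finset.mem_filter, Finset.mem_univ, true_and] at he he'
      exact Subtype.ext ((critical_edge_eq hk hkm e he.1 he.2).trans
        (critical_edge_eq hk hkm e' he'.1 he'.2).symm)
    exact_mod_cast this
  have h0 : 0 ≤ (H (colorVec h) * Y Q).trace + ∑ l, U (colorVec h) l * V l Q :=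
    add_nonneg (trace_mul_nonneg_of_posSemidef (hH _ hu) (hY Q hQcard))
      (Finset.sum_nonneg fun l _ => mul_nonneg (hU _ l) (hV l Q))
  have := hfact Q (colorVec h) hQcard hu
  linarith

/-! ### The canonical statement lives at polynomially small `ε` -/

/-- **Only polynomially small shifts matter.** For every `δ` the canonical cone-rank statement
("for every `c`, eventually, for EVERY `ε > 0`, `D - εJ` has no `(PSD_q ⊕ ℝ^r_{≥0})`-factorisation with
`q + r ≤ m^c`", `k = ⌈m^δ⌉₊`) is equivalent to its restriction to `0 < ε ≤ m^{-c}`: a factorisation at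
any `ε` can be pushed down to `min ε m^{-(c+1)}` at the cost of one extra non-negative term
(`cliqueDist_coneFactorisation_of_le`; shifts `ε > 1` carry no factorisation at all,
`cliqueDist_noConeFactorisation_of_one_lt`). So the crux is exactly its `ε → 0⁺` (ε-sensitive) core, while a
refutation needs a small factorisation at a single `ε ∈ (0, 1]` only. [folklore] -/
theorem cliqueDistConeRankHard_iff_small_eps : ∀ δ : ℝ,
    (∀ c : ℕ, ∀ᶠ m : ℕ in Filter.atTop, ∀ ε : ℝ, 0 < ε → ∀ (q r : ℕ), q + r ≤ m ^ c →
      ∀ (H : ((⊤ : SimpleGraph (Fin m)).edgeSet → Bool) → Matrix (Fin q) (Fin q) ℝ) (Y : Finset (Fin m) → Matrix (Fin q) (Fin q) ℝ)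
        (U : ((⊤ : SimpleGraph (Fin m)).edgeSet → Bool) → Fin r → ℝ) (V : Fin r → Finset (Fin m) → ℝ),
        (∀ u, cliqueFn m ⌈(m : ℝ) ^ δ⌉₊ u = false → (H u).PosSemidef) →
        (∀ Q : Finset (Fin m), Q.card = ⌈(m : ℝ) ^ δ⌉₊ → (Y Q).PosSemidef) →
        (∀ u l, 0 ≤ U u l) → (∀ l Q, 0 ≤ V l Q) →
        ¬ ∀ (Q : Finset (Fin m)) (u : (⊤ : SimpleGraph (Fin m)).edgeSet → Bool), Q.card = ⌈(m : ℝ) ^ δ⌉₊ → cliqueFn m ⌈(m : ℝ) ^ δ⌉₊ u = false →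
            (∑ e, if cliqueVec Q e = true ∧ u e = false then (1 : ℝ) else 0) - ε =
              (H u * Y Q).trace + ∑ l, U u l * V l Q) ↔
    (∀ c : ℕ, ∀ᶠ m : ℕ in Filter.atTop, ∀ ε : ℝ, 0 < ε → ε ≤ ((m : ℝ) ^ c)⁻¹ → ∀ (q r : ℕ), q + r ≤ m ^ c →
      ∀ (H : ((⊤ : SimpleGraph (Fin m)).edgeSet → Bool) → Matrix (Fin q) (Fin q) ℝ) (Y : Finset (Fin m) → Matrix (Fin q) (Fin q) ℝ)
        (U : ((⊤ : SimpleGraph (Fin m)).edgeSet → Bool) → Fin r → ℝ) (V : Fin r → Finset (Fin m) → ℝ),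
        (∀ u, cliqueFn m ⌈(m : ℝ) ^ δ⌉₊ u = false → (H u).PosSemidef) →
        (∀ Q : Finset (Fin m), Q.card = ⌈(m : ℝ) ^ δ⌉₊ → (Y Q).PosSemidef) →
        (∀ u l, 0 ≤ U u l) → (∀ l Q, 0 ≤ V l Q) →
        ¬ ∀ (Q : Finset (Fin m)) (u : (⊤ : SimpleGraph (Fin m)).edgeSet → Bool), Q.card = ⌈(m : ℝ) ^ δ⌉₊ → cliqueFn m ⌈(m : ℝ) ^ δ⌉₊ u = false →
            (∑ e, if cliqueVec Q e = true ∧ u e = false then (1 : ℝ) else 0) - ε =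
              (H u * Y Q).trace + ∑ l, U u l * V l Q) := by
  intro δ
  classical
  constructor
  · intro h c
    filter_upwards [h c] with m hm ε hε _ q r hqr H Y U V hH hY hU hV
    exact hm ε hε q r hqr H Y U V hH hY hU hV
  · intro h c
    -- eventually `m ≥ 2`, so that `m^c + 1 ≤ m^(c+1)`
    filter_upwards [h (c + 1), Filter.eventually_ge_atTop 2] with m hm hm2
      ε hε q r hqr H Y U V hH hY hU hV hfact
    -- push the factorisation down to `ε₀ = min ε m^{-(c+1)}` with one extra non-negative term
    -- (for `ε > 1` there is nothing to push: `cliqueDist_noConeFactorisation_of_one_lt`; the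
    -- shift trick does not even need that)
    set ε₀ : ℝ := min ε (((m : ℝ) ^ (c + 1))⁻¹) with hε₀
    have hmpow : (0 : ℝ) < (m : ℝ) ^ (c + 1) := by positivity
    have hε₀pos : 0 < ε₀ := lt_min hε (inv_pos.2 hmpow)
    have hε₀le : ε₀ ≤ ε := min_le_left _ _
    have hε₀small : ε₀ ≤ ((m : ℝ) ^ (c + 1))⁻¹ := min_le_right _ _
    obtain ⟨U', V', hU', hV', hfact'⟩ := cliqueDist_coneFactorisation_of_le hε₀le H Y U V hU hV hfact
    have hbudget : q + (r + 1) ≤ m ^ (c + 1) := by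
      have h1 : 1 ≤ m ^ c := Nat.one_le_pow _ _ (by omega)
      calc q + (r + 1) ≤ m ^ c + m ^ c := by omega
        _ = 2 * m ^ c := by ring
        _ ≤ m * m ^ c := Nat.mul_le_mul_right _ hm2
        _ = m ^ (c + 1) := by ring
    exact hm ε₀ hε₀pos (by exact_mod_cast hε₀small) q _ hbudget H Y U' V' hH hY hU' hV' hfact' 

end Summit.PneNP.PneNP.Theorems
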